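import Literature.InformationTheory.QuantumCodes.UnionFindDecoderRadius
import Literature.InformationTheory.QuantumCodes.UnionFindDecoderDual
import HarnessLib

/-!
# Ventures/QEC — Decoders: the Union-Find decoder of the `L × L` toric code has the OPTIMAL certified
# correction radius `⌊(L-1)/2⌋`, and corrects `t` erasures + `s` errors whenever `t + 2s < L` (Q4 family row)

HONEST FRAMING: CERTIFIED column, tier KERNEL (axioms ⊆ {propext, Classical.choice, Quot.sound}; no
`decide` tables, no named fact). This is a FAMILY statement (every `L`), packaging the Literature theorems
of `UnionFindDecoderRadius.lean` (Delfosse–Nickerson 2021, Quantum 5:595, §3 Theorem 1, proved there for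
the toric code; the objects — Algorithm 1 as a synchronous half-link growth process, `UnionFind.IsOutput`
= any peeling choice inside the grown erasure, the decoder `UnionFind.ufDecoder R` — are those of
`UnionFindDecoder.lean`). What is certified, for every `L ≥ 1`:

* `toric_unionFind_output_mem_boundaries` — erasure `R`, `Z`-error chain `e` with
  `|R| + 2·|supp e \ R| < L`: EVERY valid output `C` of Algorithm 1 closes `e` to a boundary;
* `toric_unionFind_corrects_mixed` — hence the decoder corrects every such `(R, e)` (DKLP success
  criterion `Decoder.Corrects`);
* `toric_unionFind_isCorrectionRadius` — without erasure its correction radius IS `⌊(L-1)/2⌋`, the optimal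
  `Z`-radius of the toric code (`ToricCode.optimalRadiusZ`: no decoder corrects all errors of a larger weight);
* `toric_unionFindX_corrects_mixed`, `toric_unionFindX_isCorrectionRadius` — the same for BIT-FLIP errors
  (plaquette syndromes, residual in the row space of `H^X`) with the dual-lattice decoder `UnionFind.ufDecoderX`
  (`UnionFindDecoderDual.lean`): the decoder PAIR `(ufDecoderX, ufDecoder)` has certified radius `⌊(L-1)/2⌋` in
  both sectors.

VALIDATED-column statements about Union-Find (thresholds 9.9 % / 2.6 %, almost-linear complexity) are NOT
here (they are SIMULATED / algorithmic, HOME/lit/LIT2-REGISTER.md §E rows 3, 10).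
bears_on: LADDER-QEC Q4 (decoder as a function with a certified radius) — union-find lane; LIT-2.
-/

namespace Summit.Ventures.QEC.Decoders

open Literature.InformationTheory.QuantumCodes Literature.InformationTheory.QuantumCodes.ToricCode

/-- **Every output of the Union-Find decoder is correct when `t + 2s < L`** (Delfosse–Nickerson 2021 Thm 1,
toric code): for an erasure `R` and an error chain `e` with `|R| + 2·|supp e \ R| < L`, every chain `C`
inside the grown erasure with syndrome `∂e` satisfies `e + C ∈ boundaries L`.
[cite: DelfosseNickerson2021, §3 Theorem 1] -/
theorem toric_unionFind_output_mem_boundaries (L : ℕ) [NeZero L] (R : Finset (Edge L)) (e : Chain L)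
    (h : R.card + 2 * (supp e \ R).card < L) {C : Chain L} (hC : UnionFind.IsOutput (syn L e) R C) :
    e + C ∈ boundaries L :=
  UnionFind.DelfosseNickerson2021_theorem1_toric e R h hC

/-- **The Union-Find decoder corrects `t` erasures and `s` residual `Z`-errors whenever `t + 2s < L`.**
[cite: DelfosseNickerson2021, §3 Theorem 1] -/
theorem toric_unionFind_corrects_mixed (L : ℕ) [NeZero L] (R : Finset (Edge L)) (e : Chain L)
    (h : R.card + 2 * (supp e \ R).card < L) :
    (UnionFind.ufDecoder R).Corrects (syn L) (boundaries L) e :=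
  UnionFind.ufDecoder_corrects R e h

/-- **Q4 family row: the Union-Find decoder of the `L × L` toric code (no erasure) has certified correction
radius exactly `⌊(L-1)/2⌋`, the optimal one.** [cite: DelfosseNickerson2021, §3 Theorem 1 and ¶2] -/
theorem toric_unionFind_isCorrectionRadius (L : ℕ) [NeZero L] :
    (UnionFind.ufDecoder (∅ : Finset (Edge L))).IsCorrectionRadius (syn L) (boundaries L) hammingNorm
      ((L - 1) / 2) :=
  UnionFind.ufDecoder_isCorrectionRadius

/-- **Bit flips: the `X`-sector Union-Find decoder corrects `t` erasures and `s` residual `X`-errors whenever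
`t + 2s < L`.** [cite: DelfosseNickerson2021, §3 Theorem 1, §1 ("the X-part … can be corrected identically")] -/
theorem toric_unionFindX_corrects_mixed (L : ℕ) [NeZero L] (R : Finset (Edge L)) (x : Chain L)
    (h : R.card + 2 * (supp x \ R).card < L) :
    (UnionFind.ufDecoderX R).Corrects (toricCode L).xSyndrome ((toricCode L).rowSpX : Set (Chain L)) x :=
  UnionFind.ufDecoderX_corrects R x h

/-- **Q4 family row, `X` sector: the dual-lattice Union-Find decoder of the `L × L` toric code (no erasure) has
certified bit-flip correction radius exactly `⌊(L-1)/2⌋`, the optimal one** (`ToricCode.optimalRadiusX`).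
[cite: DelfosseNickerson2021, §3 Theorem 1 and ¶2, §1] -/
theorem toric_unionFindX_isCorrectionRadius (L : ℕ) [NeZero L] :
    (UnionFind.ufDecoderX (∅ : Finset (Edge L))).IsCorrectionRadius (toricCode L).xSyndrome
      ((toricCode L).rowSpX : Set (Chain L)) hammingNorm ((L - 1) / 2) :=
  UnionFind.ufDecoderX_isCorrectionRadius

end Summit.Ventures.QEC.Decoders
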